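import Literature.Computability.AlgebraicComplexity.HomDepthFourUpperBound
import Literature.Computability.AlgebraicComplexity.HomogeneousDepthFour
import HarnessLib

/-!
# Reduction of Kumar–Saraf's `n^{Ω(√n)}` bound for homogeneous `ΣΠΣΠ` circuits to the
combinatorial core (Kumar–Saraf 2017, proof of Thm. 8.10: Lemma 8.2 + eq. (4.1) versus Lemma 8.9)

Topic `Literature/Computability/AlgebraicComplexity`; assembly file for the printed proof of the
named fact `kumarSaraf2017_imm_homDepthFour` (`HomogeneousDepthFour.lean`).

The printed proof of Thm. 8.10 has a CIRCUIT side — a homogeneous `ΣΠΣΠ` circuit of size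
`< n^{ε√n}` has few bottom product gates, so a restriction `V` killing all its bottom monomials of
support `> s` makes `C|_V` a `ΣΠΣΠ^{{s}}` circuit, whose measure is at most
`size · binom · binom` (Lemma 8.2, Lemma 4.1 = eq. (4.1)) — and a POLYNOMIAL side — for the same
`V`, `Φ_{𝒢_V,m}(IMM|_V)` is large (Lemma 8.9); the union bound provides a `V` doing both. This file
proves the circuit side in full, in the tree's model, as the implication
`kumarSaraf2017_imm_homDepthFour_of_core`: the named fact follows from the purely combinatorial
statement about the polynomial `IMM` (no circuits) that for every family `B` of at most
`⌈n^{ε√n}⌉` "bad" sets of more than `s` variables there is a set `V` of variables avoiding every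
member of `B` (i.e. no bad monomial survives the restriction to `V`) together with derivative
operators of a common order `r` and a shift degree `m` for which
`Φ(IMM|_V) > ⌈n^{ε√n}⌉ · #{A ⊆ [2n/s+1] : |A| ≤ r} · ∑_{i ≤ rs} C(N, m+i)`.
(In print this `V` is a sample of the distribution `𝒟` of §8.3: Lemma 8.2 gives the avoidance with
probability `1 - o(1)`, Lemma 8.9 the measure bound with probability `0.9`.) The proof: if a
homogeneous depth-4 circuit `P` of size `< ⌈n^{ε√n}⌉` computed `IMM_{n^c,n}`, take for `B` the
supports of its bottom monomials of support `> s` (`ArithCircuit.monoExps`, at most `size` of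
them); the resulting `V` satisfies the hypothesis of `KumarSaraf.pspDim_restrict_le`, which bounds
`Φ(IMM|_V)` by `size · (…) < ⌈n^{ε√n}⌉ · (…)`, a contradiction.

Everything here is proved (D-0026): the theorem is an implication; its hypothesis is displayed,
not assumed anywhere as a fact. Discharging that hypothesis (§8.3–§8.7, §9, §11–12 of the source:
the random restriction `𝒟`, `T₁, T₂, T₃`) is what remains for `kumarSaraf2017_imm_homDepthFour`;
the deterministic skeleton `T₁,T₂,T₃ ⟹ Φ` is `KumarSaraf.pspDim_mul_ge_of_T123`
(`ProjectedShiftedPartialsSkeleton.lean`).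

## References

* M. Kumar, S. Saraf, *On the power of homogeneous depth 4 arithmetic circuits*, SIAM J. Comput.
  46 (2017) 336–387 (arXiv:1404.1950): Lemma 8.2, Lemma 8.9, Thm. 8.10 and its proof.
-/

noncomputable section

open MvPolynomial

namespace Literature.Computability.AlgebraicComplexity

open KumarSaraf GKKS ArithCircuit

/-- **The combinatorial core of Kumar–Saraf's Thm. 8.10, as a hypothesis shape** (displayed here
for readability; this is NOT a named fact and is not assumed anywhere): over the field `K`, with
`c, n₀, ε`, for every `n ≥ n₀` there is a support threshold `s ≥ 1` such that every family `B` of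
at most `⌈n^{ε√n}⌉` sets of more than `s` variables of `IMM_{n^c,n}` is avoided by some set `V` of
variables for which, for some derivative operators of a common order `r` and some shift degree
`m`, `Φ(IMM_{n^c,n}|_V) > ⌈n^{ε√n}⌉ · #{A ⊆ [2n/s+1] : |A| ≤ r} · ∑_{i ≤ rs} C(N, m+i)`.
[cite: KumarSaraf2017, Lemma 8.2 and Lemma 8.9] -/
def KSCore (K : Type) [Field K] (c n₀ : ℕ) (ε : ℝ) : Prop :=
  ∀ n : ℕ, n₀ ≤ n → ∃ s : ℕ, 1 ≤ s ∧
    ∀ B : Finset (Finset (Fin n × Fin (n ^ c) × Fin (n ^ c))),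
      B.card ≤ ⌈(n : ℝ) ^ (ε * Real.sqrt n)⌉₊ → (∀ A ∈ B, s < A.card) →
      ∃ (V : Finset (Fin n × Fin (n ^ c) × Fin (n ^ c))) (r m : ℕ)
        (L : Finset (List (Fin n × Fin (n ^ c) × Fin (n ^ c)))),
        (∀ l ∈ L, l.length = r) ∧ (∀ A ∈ B, ¬ A ⊆ V) ∧
        ⌈(n : ℝ) ^ (ε * Real.sqrt n)⌉₊ *
            (numSubsetsLE (2 * n / s + 1) r *
              ∑ i ∈ Finset.range (r * s + 1),
                (Fintype.card (Fin n × Fin (n ^ c) × Fin (n ^ c))).choose (m + i)) <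
          pspDim (fun l : L => (l : List (Fin n × Fin (n ^ c) × Fin (n ^ c)))) m
            (restrictVars V (immPoly (n ^ c) n K))

/-- **The circuit side of Kumar–Saraf 2017, Thm. 8.10, for one `n`**: if the combinatorial core
holds at `n ≥ 2` with threshold `⌈n^{ε√n}⌉`, then every homogeneous depth-4 circuit computing
`IMM_{n^c,n}` has at least `⌈n^{ε√n}⌉` gates. Given a smaller circuit `P`, apply the core to the
family `B` of supports of the bottom monomials of `P` of support `> s` (at most `size(P)` sets,
`ArithCircuit.card_monoExps_le`); the resulting `V` kills them all, so
`KumarSaraf.pspDim_restrict_le` bounds `Φ(IMM|_V)` by `size(P) · (…)`, below the core's lower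
bound. [cite: KumarSaraf2017, Thm. 8.10 (proof)] -/
theorem le_homDepthFourCircuitSize_immPoly_of_core {K : Type} [Field K] {c n : ℕ} {ε : ℝ}
    (hn : 2 ≤ n) {s : ℕ} (hs : 1 ≤ s)
    (hcore : ∀ B : Finset (Finset (Fin n × Fin (n ^ c) × Fin (n ^ c))),
      B.card ≤ ⌈(n : ℝ) ^ (ε * Real.sqrt n)⌉₊ → (∀ A ∈ B, s < A.card) →
      ∃ (V : Finset (Fin n × Fin (n ^ c) × Fin (n ^ c))) (r m : ℕ)
        (L : Finset (List (Fin n × Fin (n ^ c) × Fin (n ^ c)))),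
        (∀ l ∈ L, l.length = r) ∧ (∀ A ∈ B, ¬ A ⊆ V) ∧
        ⌈(n : ℝ) ^ (ε * Real.sqrt n)⌉₊ *
            (numSubsetsLE (2 * n / s + 1) r *
              ∑ i ∈ Finset.range (r * s + 1),
                (Fintype.card (Fin n × Fin (n ^ c) × Fin (n ^ c))).choose (m + i)) <
          pspDim (fun l : L => (l : List (Fin n × Fin (n ^ c) × Fin (n ^ c)))) m
            (restrictVars V (immPoly (n ^ c) n K))) :
    ((⌈(n : ℝ) ^ (ε * Real.sqrt n)⌉₊ : ℕ) : ℕ∞) ≤ homDepthFourCircuitSize (immPoly (n ^ c) n K) := by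
  classical
  refine le_iInf₂ fun P hP => ?_
  obtain ⟨hc, h4, hh⟩ := hP
  rw [ENat.coe_le_coe]
  by_contra hlt
  push Not at hlt
  -- the bad bottom monomials of `P`
  set B : Finset (Finset (Fin n × Fin (n ^ c) × Fin (n ^ c))) :=
    (P.monoExps.filter fun e => s < e.support.card).image Finsupp.support with hB
  have hBcard : B.card ≤ ⌈(n : ℝ) ^ (ε * Real.sqrt n)⌉₊ :=
    calc B.card ≤ (P.monoExps.filter fun e => s < e.support.card).card := Finset.card_image_le
      _ ≤ P.monoExps.card := Finset.card_filter_le _ _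
      _ ≤ P.size := P.card_monoExps_le
      _ ≤ _ := hlt.le
  have hBbig : ∀ A ∈ B, s < A.card := by
    intro A hA
    rw [hB, Finset.mem_image] at hA
    obtain ⟨e, he, rfl⟩ := hA
    exact (Finset.mem_filter.1 he).2
  obtain ⟨V, r, m, L, hL, hV, hbig⟩ := hcore B hBcard hBbig
  -- `V` kills every bottom monomial of support `> s`
  have hevent : ∀ e ∈ P.monoExps, e.support ⊆ V → e.support.card ≤ s := by
    intro e he hsub
    by_contra hgt
    push Not at hgt
    exact hV e.support (Finset.mem_image.2 ⟨e, Finset.mem_filter.2 ⟨he, hgt⟩, rfl⟩) hsub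
  -- the upper bound (4.1)
  have hup := pspDim_restrict_le hc h4 hh (immPoly_isHomogeneous_holds (k := K) (n ^ c) n) hn V hs
    hevent (fun l : L => (l : List (Fin n × Fin (n ^ c) × Fin (n ^ c)))) r
    (fun l => hL l l.2) m
  have := hbig.trans_le hup
  exact absurd (Nat.lt_of_mul_lt_mul_right this) (not_lt.2 hlt.le)

/-- **Kumar–Saraf 2017, Thm. 1.2 / Thm. 8.10 from its combinatorial core.** If for every field
`K` there are `c, n₀, ε > 0` with `KSCore K c n₀ ε` (for all large `n`: every family of at most
`⌈n^{ε√n}⌉` sets of `> s` variables is avoided by a restriction under which `IMM_{n^c,n}` keeps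
projected-shifted-partial dimension above `⌈n^{ε√n}⌉ ·` (the circuit-side bound (4.1)) — in print,
Lemma 8.2 with Lemma 8.9 via the union bound over `V ← 𝒟`), then the named fact
`kumarSaraf2017_imm_homDepthFour` holds. The circuit side (normal form (3.1), Lemma 4.1,
restriction, `T ≤ size`, `#bottom monomials ≤ size`) is entirely proved
(`le_homDepthFourCircuitSize_immPoly_of_core`). [cite: KumarSaraf2017, Thm. 8.10 (proof)] -/
theorem kumarSaraf2017_imm_homDepthFour_of_core
    (hcore : ∀ (K : Type) [Field K], ∃ (c n₀ : ℕ) (ε : ℝ), 0 < ε ∧ KSCore K c n₀ ε) :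
    kumarSaraf2017_imm_homDepthFour := by
  intro K _
  obtain ⟨c, n₀, ε, hε, h⟩ := hcore K
  refine ⟨c, max n₀ 2, ε, hε, fun n hn => ?_⟩
  obtain ⟨s, hs, hcoreN⟩ := h n ((le_max_left n₀ 2).trans hn)
  exact le_homDepthFourCircuitSize_immPoly_of_core ((le_max_right n₀ 2).trans hn) hs hcoreN

end Literature.Computability.AlgebraicComplexity

end
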